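import Summits.PneNP.PneNP.Theorems.ConvexRankGatesCliqueExtLowerBoundUnitCnfPos
import Summits.PneNP.PneNP.Theorems.ConvexRankGatesCliqueExtLowerBoundUnitCnfNeg
import Summits.PneNP.PneNP.Theorems.ConvexRankGatesCliqueExtLowerBoundUnitCnfPermGate
import Summits.PneNP.PneNP.Theorems.ConvexRankGatesCliqueExtLowerBoundUnitCnfGRankGate
import Summits.PneNP.PneNP.Theorems.ConvexRankGatesCliqueExtLowerBoundUnitCnfConvGate
import Summits.PneNP.PneNP.Theorems.ConvexRankGatesCliqueExtLowerBoundHorns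
import Mathlib

/-!
# The locality threshold of the r8 leaves must grow with the size exponent (`LocalityMustGrow`)
(crux `ConvexRankGates.CliqueExtLowerBound`, stmt-PneNP-10682; line `width-threshold-certificate-sparsity`, lead c13)

The three open leaves of the line (`stub_permCnfAll`, `stub_grankCnfAll`, `stub_convCnfAll` of the registered skeleton r8)
have the quantifier shape `∀ c, ∃ r₀ s₀, ∀ r ≥ r₀, ∀ s ≥ s₀, BODY c r s`, where `BODY c r s` says that EVERY gate of the
class of size parameter `≤ m^c`, composed with `s`-local monotone CNFs of the edge slots, admits a legal `(r,s)`-local pair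
`dnf ≤ cnf` that loses `≤ 1/(8m^{c+1})` of the bare `⌈m^{1/4}⌉₊`-cliques it accepts and accepts `≤ 1/(8m^{c+1})` of the
dense negatives it rejects. This file proves that the order of the quantifiers is LOAD-BEARING and that the quadratic
growth `r₀(c) = Θ(c²)` of the landed engine is order-optimal (strategist census, generation 2, items S9/N8, target
`LocalityMustGrow`, there on paper):

* `unitCnf_not_sandwichable` — THE WITNESS. For `2 ≤ r ≤ C(j,2)` and `3j < 4(c+1)`, eventually in `m`, the pattern
  function "all `r` edges of a fixed `P ⊆ E(K_U)`, `#U = j`, are on" admits NO legal `(r,s)`-local sandwich at level `c`: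
  it accepts `≥ C(m-j,k-j) > #P/(8m^{c+1})` bare cliques (`UnitCnfPos.unitCnf_pos_count`, p163210) and rejects MORE than
  `(1/(8m^{c+1}) + (r-1)/⌊m^{1/8}⌋₊)·#N` negatives (`UnitCnfNeg.unitCnf_neg_count`, p163376), which the dual horn
  `Horns.horns_of_pair` forbids for a sandwichable function.
* `permCnfAllAt_false`, `grankCnfAllAt_false`, `convCnfAllAt_false` — the pattern function is ONE identity gate of each
  class reading ONE CNF of `r` unit clauses (`UnitCnfPermGate.exists_permGate_unitCnf` p163060,
  `UnitCnfGRankGate.exists_grankGate_unitCnf` p163140, `UnitCnfConvGate.exists_convGate_unitCnf` p162996), so each r8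
  leaf BODY is FALSE at every `(c, r, s)` with `2 ≤ r ≤ C(j,2)`, `3j < 4(c+1)`, `2 ≤ s`.
* `not_permCnfAll_uniform` (and GRANK, CONV) — the uniform-locality strengthening `∃ r₀ s₀, ∀ c` of each leaf is FALSE.
* `permCnfAll_threshold` (and GRANK, CONV) — any admissible threshold of a leaf at level `c` satisfies `C(j,2) < r₀`
  whenever `3j < 4(c+1)`, i.e. `r₀(c) > C(⌈4(c+1)/3⌉ - 1, 2) ≈ (8/9)c²`.

Nothing here touches the leaves as registered (`∀ c, ∃ r₀ s₀`): the witness only bounds the prover's choice of `r₀`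
from below; every `r > C(j,2)` case is exactly as open as before.
-/

set_option linter.dupNamespace false

open Literature.Computability.Complexity Filter Finset
open Summit.PneNP.PneNP.Theorems.CliqueExtLowerBound.WidthThreshold

noncomputable section

namespace Summit.PneNP.PneNP.Theorems.CliqueExtLowerBound.WidthThreshold.LocalityMustGrow

/-! ## §1 The witness pattern and its non-sandwichability -/

/-- For `j ≤ m` and `r ≤ C(j,2)` there are a `j`-set `U` of vertices and `r` edge slots inside `U`
(`Referee.choose_two_le_card_edgesIn`). [folklore] -/
theorem exists_pattern {m j r : ℕ} (hjm : j ≤ m) (hr : r ≤ j.choose 2) :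
    ∃ (U : Finset (Fin m)) (P : Finset (EV m)), #U = j ∧ #P = r ∧
      ∀ e ∈ P, ∀ v ∈ (e : Sym2 (Fin m)), v ∈ U := by
  classical
  obtain ⟨U, -, hU⟩ : ∃ U : Finset (Fin m), U ⊆ univ ∧ #U = j :=
    exists_subset_card_eq (by simpa using hjm)
  have hEU := Referee.choose_two_le_card_edgesIn (m := m) U
  rw [hU] at hEU
  obtain ⟨P, hPU, hP⟩ := exists_subset_card_eq (hr.trans hEU)
  exact ⟨U, P, hU, hP, fun e he => (mem_filter.1 (hPU he)).2⟩

/-- `2 ≤ r ≤ C(j,2)` and `3j < 4(c+1)` force `3 ≤ j` and `2 ≤ c`. [folklore] -/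
theorem two_le_of_params {c r j : ℕ} (hr : 2 ≤ r) (hrj : r ≤ j.choose 2) (hcj : 3 * j < 4 * (c + 1)) :
    3 ≤ j ∧ 2 ≤ c := by
  have hj : 3 ≤ j := by
    by_contra h
    push Not at h
    interval_cases j <;> simp_all [Nat.choose]
    omega
  exact ⟨hj, by omega⟩

open Classical in
/-- **THE WITNESS (`LocalityMustGrow`).** For `2 ≤ r ≤ C(j,2)` and `3j < 4(c+1)`: eventually in `m` there is a set `P` of
`r` edge slots inside a `j`-set of vertices such that the pattern function `x ↦ [∀ e ∈ P, x e]` admits NO legal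
`(r,s)`-local pair `dnf ≤ cnf` with both errors `≤ 1/(8m^{c+1})` on the referee pair (positives `posGraphs m ⌈m^{1/4}⌉₊`,
negatives the complements of the `(#E/⌊m^{1/8}⌋₊)`-subsets of the slots) — by the dual horn `Horns.horns_of_pair` and the
two counts `UnitCnfPos.unitCnf_pos_count`, `UnitCnfNeg.unitCnf_neg_count`. The clause width `s` is arbitrary. [folklore] -/
theorem unitCnf_not_sandwichable : ∀ c r s j : ℕ, 2 ≤ r → r ≤ j.choose 2 → 3 * j < 4 * (c + 1) →
    ∀ᶠ m : ℕ in atTop, ∃ P : Finset (EV m), #P = r ∧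
      (∃ U : Finset (Fin m), #U = j ∧ ∀ e ∈ P, ∀ v ∈ (e : Sym2 (Fin m)), v ∈ U) ∧
      ¬ ∃ dnf cnf : Finset (Finset (EV m)), (∀ R ∈ dnf, #R ≤ r - 1) ∧ (∀ S ∈ cnf, #S ≤ s - 1) ∧
        (∀ x, EvalDNF dnf x → EvalCNF cnf x) ∧
        (#((posGraphs m ⌈(m : ℝ) ^ (1 / 4 : ℝ)⌉₊).filter
            (fun x => decide (∀ e ∈ P, x e = true) = true ∧ ¬ EvalDNF dnf x)) : ℝ)
          ≤ (1 / (8 * (m : ℝ) ^ (c + 1))) * #(posGraphs m ⌈(m : ℝ) ^ (1 / 4 : ℝ)⌉₊) ∧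
        (#((((powersetCard (Fintype.card (EV m) / ⌊(m : ℝ) ^ (1 / 8 : ℝ)⌋₊)
          (univ : Finset (EV m))).image (fun M => fun e => decide (e ∉ M)))).filter
            (fun x => EvalCNF cnf x ∧ decide (∀ e ∈ P, x e = true) = false)) : ℝ)
          ≤ (1 / (8 * (m : ℝ) ^ (c + 1))) *
            #(((powersetCard (Fintype.card (EV m) / ⌊(m : ℝ) ^ (1 / 8 : ℝ)⌋₊)
          (univ : Finset (EV m))).image (fun M => fun e => decide (e ∉ M)))) := by
  intro c r s j hr hrj hcj
  filter_upwards [UnitCnfPos.unitCnf_pos_count c j hcj, UnitCnfNeg.unitCnf_neg_count c r (by omega),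
    eventually_ge_atTop (max j 1)] with m hpos hneg hm
  obtain ⟨U, P, hU, hP, hPU⟩ := exists_pattern (m := m) (le_of_max_le_left hm) hrj
  refine ⟨P, hP, ⟨U, hU, hPU⟩, fun hsand => ?_⟩
  have hm1 : 1 ≤ m := le_of_max_le_right hm
  rcases Horns.horns_of_pair hm1 (fun x => decide (∀ e ∈ P, x e = true))
      (posGraphs m ⌈(m : ℝ) ^ (1 / 4 : ℝ)⌉₊) (1 / (8 * (m : ℝ) ^ (c + 1))) hsand with h1 | h2
  · have hp := hpos U hU P hPU
    have h1' : (#((posGraphs m ⌈(m : ℝ) ^ (1 / 4 : ℝ)⌉₊).filter fun x => ∀ e ∈ P, x e = true) : ℝ) ≤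
        (1 / (8 * (m : ℝ) ^ (c + 1))) * #(posGraphs m ⌈(m : ℝ) ^ (1 / 4 : ℝ)⌉₊) := by
      simpa using h1
    linarith
  · have hn := hneg P hP
    have h2' : (#((((powersetCard (Fintype.card (EV m) / ⌊(m : ℝ) ^ (1 / 8 : ℝ)⌋₊)
          (univ : Finset (EV m))).image (fun M => fun e => decide (e ∉ M)))).filter
            fun x => ¬ ∀ e ∈ P, x e = true) : ℝ) ≤
        (1 / (8 * (m : ℝ) ^ (c + 1)) + ((r - 1 : ℕ) : ℝ) / ⌊(m : ℝ) ^ (1 / 8 : ℝ)⌋₊) *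
          #((powersetCard (Fintype.card (EV m) / ⌊(m : ℝ) ^ (1 / 8 : ℝ)⌋₊)
          (univ : Finset (EV m))).image (fun M => fun e => decide (e ∉ M))) := by
      have hf : (((powersetCard (Fintype.card (EV m) / ⌊(m : ℝ) ^ (1 / 8 : ℝ)⌋₊)
          (univ : Finset (EV m))).image (fun M => fun e => decide (e ∉ M))).filter
            fun x => decide (∀ e ∈ P, x e = true) = false) =
          (((powersetCard (Fintype.card (EV m) / ⌊(m : ℝ) ^ (1 / 8 : ℝ)⌋₊)
          (univ : Finset (EV m))).image (fun M => fun e => decide (e ∉ M))).filter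
            fun x => ¬ ∀ e ∈ P, x e = true) :=
        filter_congr fun x _ => by rw [decide_eq_false_iff_not]
      rw [hf] at h2
      exact h2
    linarith

/-! ## §2 Each r8 leaf body is false below the quadratic threshold -/

open Classical in
/-- **The r8 PERM leaf body is FALSE at `(c, r, s)` whenever `2 ≤ r ≤ C(j,2)`, `3j < 4(c+1)`, `2 ≤ s`.** The body is the
text of the registered stub `stub_permCnfAll` after its prefix `∀ c, ∃ r₀ s₀, …, ∀ r s, r₀ ≤ r → s₀ ≤ s →` (`IsPermGate (m^c) φ` — permutation-group membership on `≤ m^c` points).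
Witness: the pattern of `unitCnf_not_sandwichable`, realised as one identity gate of the class reading one CNF of unit
clauses. [folklore] -/
theorem permCnfAllAt_false : ∀ c r s j : ℕ, 2 ≤ r → 2 ≤ s → r ≤ j.choose 2 → 3 * j < 4 * (c + 1) →
    ¬ (∀ᶠ m : ℕ in atTop, ∀ φ : GateFn, IsPermGate (m ^ c) φ →
      ∀ C : Fin φ.1 → Finset (Finset ((⊤ : SimpleGraph (Fin m)).edgeSet)),
        #(univ.image C) ≤ m ^ (c + 3) → (∀ j, ∀ S ∈ C j, #S ≤ s - 1) →
        ∃ dnf cnf : Finset (Finset ((⊤ : SimpleGraph (Fin m)).edgeSet)),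
          (∀ R ∈ dnf, #R ≤ r - 1) ∧ (∀ S ∈ cnf, #S ≤ s - 1) ∧
          (∀ x, EvalDNF dnf x → EvalCNF cnf x) ∧
          (#((posGraphs m ⌈(m : ℝ) ^ (1 / 4 : ℝ)⌉₊).filter
              (fun x => φ.2 (fun j => decide (EvalCNF (C j) x)) = true ∧ ¬ EvalDNF dnf x)) : ℝ)
            ≤ (1 / (8 * (m : ℝ) ^ (c + 1))) * #(posGraphs m ⌈(m : ℝ) ^ (1 / 4 : ℝ)⌉₊) ∧
          (#((((powersetCard (Fintype.card ((⊤ : SimpleGraph (Fin m)).edgeSet) / ⌊(m : ℝ) ^ (1 / 8 : ℝ)⌋₊)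
          (univ : Finset ((⊤ : SimpleGraph (Fin m)).edgeSet))).image (fun M => fun e => decide (e ∉ M)))).filter
              (fun x => EvalCNF cnf x ∧ φ.2 (fun j => decide (EvalCNF (C j) x)) = false)) : ℝ)
            ≤ (1 / (8 * (m : ℝ) ^ (c + 1))) *
              #(((powersetCard (Fintype.card ((⊤ : SimpleGraph (Fin m)).edgeSet) / ⌊(m : ℝ) ^ (1 / 8 : ℝ)⌋₊)
          (univ : Finset ((⊤ : SimpleGraph (Fin m)).edgeSet))).image (fun M => fun e => decide (e ∉ M))))) := by
  intro c r s j hr hs hrj hcj hleaf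
  obtain ⟨m, ⟨P, -, -, hcore⟩, hleafm, hm2⟩ :=
    ((unitCnf_not_sandwichable c r s j hr hrj hcj).and (hleaf.and (eventually_ge_atTop 2))).exists
  have hc : 2 ≤ c := (two_le_of_params hr hrj hcj).2
  obtain ⟨φ, C, hφ, hC1, hCs, hφC⟩ := UnitCnfPermGate.exists_permGate_unitCnf m (m ^ c) s
      (hm2.trans (Nat.le_self_pow (by omega) m)) hs P
  have h := hleafm φ hφ C (hC1.trans (Nat.one_le_pow _ _ (by omega))) hCs
  simp only [hφC] at h
  exact hcore h

open Classical in
/-- **The r8 GRANK leaf body is FALSE at `(c, r, s)` whenever `2 ≤ r ≤ C(j,2)`, `3j < 4(c+1)`, `2 ≤ s`.** The body is the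
text of the registered stub `stub_grankCnfAll` after its prefix `∀ c, ∃ r₀ s₀, …, ∀ r s, r₀ ≤ r → s₀ ≤ s →` (`IsGRankGate (m^c) φ` — generic-rank thresholds of dimension `≤ m^c`).
Witness: the pattern of `unitCnf_not_sandwichable`, realised as one identity gate of the class reading one CNF of unit
clauses. [folklore] -/
theorem grankCnfAllAt_false : ∀ c r s j : ℕ, 2 ≤ r → 2 ≤ s → r ≤ j.choose 2 → 3 * j < 4 * (c + 1) →
    ¬ (∀ᶠ m : ℕ in atTop, ∀ φ : GateFn, IsGRankGate (m ^ c) φ →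
      ∀ C : Fin φ.1 → Finset (Finset ((⊤ : SimpleGraph (Fin m)).edgeSet)),
        #(univ.image C) ≤ m ^ (c + 3) → (∀ j, ∀ S ∈ C j, #S ≤ s - 1) →
        ∃ dnf cnf : Finset (Finset ((⊤ : SimpleGraph (Fin m)).edgeSet)),
          (∀ R ∈ dnf, #R ≤ r - 1) ∧ (∀ S ∈ cnf, #S ≤ s - 1) ∧
          (∀ x, EvalDNF dnf x → EvalCNF cnf x) ∧
          (#((posGraphs m ⌈(m : ℝ) ^ (1 / 4 : ℝ)⌉₊).filter
              (fun x => φ.2 (fun j => decide (EvalCNF (C j) x)) = true ∧ ¬ EvalDNF dnf x)) : ℝ)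
            ≤ (1 / (8 * (m : ℝ) ^ (c + 1))) * #(posGraphs m ⌈(m : ℝ) ^ (1 / 4 : ℝ)⌉₊) ∧
          (#((((powersetCard (Fintype.card ((⊤ : SimpleGraph (Fin m)).edgeSet) / ⌊(m : ℝ) ^ (1 / 8 : ℝ)⌋₊)
          (univ : Finset ((⊤ : SimpleGraph (Fin m)).edgeSet))).image (fun M => fun e => decide (e ∉ M)))).filter
              (fun x => EvalCNF cnf x ∧ φ.2 (fun j => decide (EvalCNF (C j) x)) = false)) : ℝ)
            ≤ (1 / (8 * (m : ℝ) ^ (c + 1))) *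
              #(((powersetCard (Fintype.card ((⊤ : SimpleGraph (Fin m)).edgeSet) / ⌊(m : ℝ) ^ (1 / 8 : ℝ)⌋₊)
          (univ : Finset ((⊤ : SimpleGraph (Fin m)).edgeSet))).image (fun M => fun e => decide (e ∉ M))))) := by
  intro c r s j hr hs hrj hcj hleaf
  obtain ⟨m, ⟨P, -, -, hcore⟩, hleafm, hm2⟩ :=
    ((unitCnf_not_sandwichable c r s j hr hrj hcj).and (hleaf.and (eventually_ge_atTop 2))).exists
  have hc : 2 ≤ c := (two_le_of_params hr hrj hcj).2
  obtain ⟨φ, C, hφ, hC1, hCs, hφC⟩ := UnitCnfGRankGate.exists_grankGate_unitCnf m (m ^ c) s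
      (Nat.one_le_pow _ _ (by omega)) hs P
  have h := hleafm φ hφ C (hC1.trans (Nat.one_le_pow _ _ (by omega))) hCs
  simp only [hφC] at h
  exact hcore h

open Classical in
/-- **The r8 CONV leaf body is FALSE at `(c, r, s)` whenever `2 ≤ r ≤ C(j,2)`, `3j < 4(c+1)`, `2 ≤ s`.** The body is the
text of the registered stub `stub_convCnfAll` after its prefix `∀ c, ∃ r₀ s₀, …, ∀ r s, r₀ ≤ r → s₀ ≤ s →` (`IsConvGate (m^c) φ` — SDP-feasibility gates of width `≤ m^c`).
Witness: the pattern of `unitCnf_not_sandwichable`, realised as one identity gate of the class reading one CNF of unit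
clauses. [folklore] -/
theorem convCnfAllAt_false : ∀ c r s j : ℕ, 2 ≤ r → 2 ≤ s → r ≤ j.choose 2 → 3 * j < 4 * (c + 1) →
    ¬ (∀ᶠ m : ℕ in atTop, ∀ φ : GateFn, IsConvGate (m ^ c) φ →
      ∀ C : Fin φ.1 → Finset (Finset ((⊤ : SimpleGraph (Fin m)).edgeSet)),
        #(univ.image C) ≤ m ^ (c + 3) → (∀ j, ∀ S ∈ C j, #S ≤ s - 1) →
        ∃ dnf cnf : Finset (Finset ((⊤ : SimpleGraph (Fin m)).edgeSet)),
          (∀ R ∈ dnf, #R ≤ r - 1) ∧ (∀ S ∈ cnf, #S ≤ s - 1) ∧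
          (∀ x, EvalDNF dnf x → EvalCNF cnf x) ∧
          (#((posGraphs m ⌈(m : ℝ) ^ (1 / 4 : ℝ)⌉₊).filter
              (fun x => φ.2 (fun j => decide (EvalCNF (C j) x)) = true ∧ ¬ EvalDNF dnf x)) : ℝ)
            ≤ (1 / (8 * (m : ℝ) ^ (c + 1))) * #(posGraphs m ⌈(m : ℝ) ^ (1 / 4 : ℝ)⌉₊) ∧
          (#((((powersetCard (Fintype.card ((⊤ : SimpleGraph (Fin m)).edgeSet) / ⌊(m : ℝ) ^ (1 / 8 : ℝ)⌋₊)
          (univ : Finset ((⊤ : SimpleGraph (Fin m)).edgeSet))).image (fun M => fun e => decide (e ∉ M)))).filter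
              (fun x => EvalCNF cnf x ∧ φ.2 (fun j => decide (EvalCNF (C j) x)) = false)) : ℝ)
            ≤ (1 / (8 * (m : ℝ) ^ (c + 1))) *
              #(((powersetCard (Fintype.card ((⊤ : SimpleGraph (Fin m)).edgeSet) / ⌊(m : ℝ) ^ (1 / 8 : ℝ)⌋₊)
          (univ : Finset ((⊤ : SimpleGraph (Fin m)).edgeSet))).image (fun M => fun e => decide (e ∉ M))))) := by
  intro c r s j hr hs hrj hcj hleaf
  obtain ⟨m, ⟨P, -, -, hcore⟩, hleafm, hm2⟩ :=
    ((unitCnf_not_sandwichable c r s j hr hrj hcj).and (hleaf.and (eventually_ge_atTop 2))).exists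
  have hc : 2 ≤ c := (two_le_of_params hr hrj hcj).2
  obtain ⟨φ, C, hφ, hC1, hCs, hφC⟩ := UnitCnfConvGate.exists_convGate_unitCnf m (m ^ c) s
      (Nat.one_le_pow _ _ (by omega)) hs P
  have h := hleafm φ hφ C (hC1.trans (Nat.one_le_pow _ _ (by omega))) hCs
  simp only [hφC] at h
  exact hcore h

/-! ## §3 Consequences: uniform locality is false; admissible thresholds are quadratic in `c` -/

/-- Generic form: if a family of statements `B c r s` fails whenever `2 ≤ r ≤ C(j,2)`, `2 ≤ s`, `3j < 4(c+1)`, then no single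
threshold pair `(r₀, s₀)` works for every `c`. [folklore] -/
theorem not_uniform_of_atFalse (B : ℕ → ℕ → ℕ → Prop)
    (hB : ∀ c r s j : ℕ, 2 ≤ r → 2 ≤ s → r ≤ j.choose 2 → 3 * j < 4 * (c + 1) → ¬ B c r s) :
    ¬ ∃ r₀ s₀ : ℕ, 2 ≤ r₀ ∧ 2 ≤ s₀ ∧ ∀ c r s : ℕ, r₀ ≤ r → s₀ ≤ s → B c r s := by
  rintro ⟨r₀, s₀, hr₀, hs₀, h⟩
  refine hB (r₀ + 1) r₀ s₀ (r₀ + 1) hr₀ hs₀ ?_ (by omega) (h _ _ _ le_rfl le_rfl)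
  rw [Nat.choose_two_right, Nat.add_sub_cancel]
  exact Nat.le_div_iff_mul_le two_pos |>.2 (by nlinarith)

/-- Generic form: such a family forces every admissible threshold `r₀` at level `c` above `C(j,2)` for all `j` with
`3j < 4(c+1)`. [folklore] -/
theorem threshold_of_atFalse (B : ℕ → ℕ → ℕ → Prop)
    (hB : ∀ c r s j : ℕ, 2 ≤ r → 2 ≤ s → r ≤ j.choose 2 → 3 * j < 4 * (c + 1) → ¬ B c r s) :
    ∀ c r₀ s₀ : ℕ, 2 ≤ r₀ → 2 ≤ s₀ → (∀ r s : ℕ, r₀ ≤ r → s₀ ≤ s → B c r s) →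
      ∀ j : ℕ, 3 * j < 4 * (c + 1) → j.choose 2 < r₀ := by
  intro c r₀ s₀ hr₀ hs₀ h j hcj
  by_contra hle
  push Not at hle
  exact hB c r₀ s₀ j hr₀ hs₀ hle hcj (h r₀ s₀ le_rfl le_rfl)

open Classical in
/-- **Uniform locality is FALSE for the PERM leaf**: there is no single threshold pair `(r₀, s₀)` making the r8 PERM leaf body
hold for every size exponent `c` (strategist census S9; the shape that would let children-free raw-gate leaves imply the
registered ones). [folklore] -/
theorem not_permCnfAll_uniform : ¬ ∃ r₀ s₀ : ℕ, 2 ≤ r₀ ∧ 2 ≤ s₀ ∧ ∀ c r s : ℕ, r₀ ≤ r → s₀ ≤ s →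
    ∀ᶠ m : ℕ in atTop, ∀ φ : GateFn, IsPermGate (m ^ c) φ →
      ∀ C : Fin φ.1 → Finset (Finset ((⊤ : SimpleGraph (Fin m)).edgeSet)),
        #(univ.image C) ≤ m ^ (c + 3) → (∀ j, ∀ S ∈ C j, #S ≤ s - 1) →
        ∃ dnf cnf : Finset (Finset ((⊤ : SimpleGraph (Fin m)).edgeSet)),
          (∀ R ∈ dnf, #R ≤ r - 1) ∧ (∀ S ∈ cnf, #S ≤ s - 1) ∧
          (∀ x, EvalDNF dnf x → EvalCNF cnf x) ∧
          (#((posGraphs m ⌈(m : ℝ) ^ (1 / 4 : ℝ)⌉₊).filter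
              (fun x => φ.2 (fun j => decide (EvalCNF (C j) x)) = true ∧ ¬ EvalDNF dnf x)) : ℝ)
            ≤ (1 / (8 * (m : ℝ) ^ (c + 1))) * #(posGraphs m ⌈(m : ℝ) ^ (1 / 4 : ℝ)⌉₊) ∧
          (#((((powersetCard (Fintype.card ((⊤ : SimpleGraph (Fin m)).edgeSet) / ⌊(m : ℝ) ^ (1 / 8 : ℝ)⌋₊)
          (univ : Finset ((⊤ : SimpleGraph (Fin m)).edgeSet))).image (fun M => fun e => decide (e ∉ M)))).filter
              (fun x => EvalCNF cnf x ∧ φ.2 (fun j => decide (EvalCNF (C j) x)) = false)) : ℝ)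
            ≤ (1 / (8 * (m : ℝ) ^ (c + 1))) *
              #(((powersetCard (Fintype.card ((⊤ : SimpleGraph (Fin m)).edgeSet) / ⌊(m : ℝ) ^ (1 / 8 : ℝ)⌋₊)
          (univ : Finset ((⊤ : SimpleGraph (Fin m)).edgeSet))).image (fun M => fun e => decide (e ∉ M)))) :=
  not_uniform_of_atFalse _ permCnfAllAt_false

open Classical in
/-- **Admissible thresholds of the PERM leaf are quadratic in `c`**: if `(r₀, s₀)` witnesses the r8 PERM leaf at level `c`
(`2 ≤ r₀`, `2 ≤ s₀`), then `C(j,2) < r₀` for every `j` with `3j < 4(c+1)` — so `r₀(c) > C(⌈4(c+1)/3⌉ - 1, 2)`, and the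
engine's `r₀ = C(4(a+c+2), 2) + 2` (`RealInline.realInline_of_engine`) is order-optimal. [folklore] -/
theorem permCnfAll_threshold : ∀ c r₀ s₀ : ℕ, 2 ≤ r₀ → 2 ≤ s₀ →
    (∀ r s : ℕ, r₀ ≤ r → s₀ ≤ s →
    ∀ᶠ m : ℕ in atTop, ∀ φ : GateFn, IsPermGate (m ^ c) φ →
      ∀ C : Fin φ.1 → Finset (Finset ((⊤ : SimpleGraph (Fin m)).edgeSet)),
        #(univ.image C) ≤ m ^ (c + 3) → (∀ j, ∀ S ∈ C j, #S ≤ s - 1) →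
        ∃ dnf cnf : Finset (Finset ((⊤ : SimpleGraph (Fin m)).edgeSet)),
          (∀ R ∈ dnf, #R ≤ r - 1) ∧ (∀ S ∈ cnf, #S ≤ s - 1) ∧
          (∀ x, EvalDNF dnf x → EvalCNF cnf x) ∧
          (#((posGraphs m ⌈(m : ℝ) ^ (1 / 4 : ℝ)⌉₊).filter
              (fun x => φ.2 (fun j => decide (EvalCNF (C j) x)) = true ∧ ¬ EvalDNF dnf x)) : ℝ)
            ≤ (1 / (8 * (m : ℝ) ^ (c + 1))) * #(posGraphs m ⌈(m : ℝ) ^ (1 / 4 : ℝ)⌉₊) ∧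
          (#((((powersetCard (Fintype.card ((⊤ : SimpleGraph (Fin m)).edgeSet) / ⌊(m : ℝ) ^ (1 / 8 : ℝ)⌋₊)
          (univ : Finset ((⊤ : SimpleGraph (Fin m)).edgeSet))).image (fun M => fun e => decide (e ∉ M)))).filter
              (fun x => EvalCNF cnf x ∧ φ.2 (fun j => decide (EvalCNF (C j) x)) = false)) : ℝ)
            ≤ (1 / (8 * (m : ℝ) ^ (c + 1))) *
              #(((powersetCard (Fintype.card ((⊤ : SimpleGraph (Fin m)).edgeSet) / ⌊(m : ℝ) ^ (1 / 8 : ℝ)⌋₊)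
          (univ : Finset ((⊤ : SimpleGraph (Fin m)).edgeSet))).image (fun M => fun e => decide (e ∉ M))))) →
    ∀ j : ℕ, 3 * j < 4 * (c + 1) → j.choose 2 < r₀ :=
  threshold_of_atFalse _ permCnfAllAt_false

open Classical in
/-- **Uniform locality is FALSE for the GRANK leaf**: there is no single threshold pair `(r₀, s₀)` making the r8 GRANK leaf body
hold for every size exponent `c` (strategist census S9; the shape that would let children-free raw-gate leaves imply the
registered ones). [folklore] -/
theorem not_grankCnfAll_uniform : ¬ ∃ r₀ s₀ : ℕ, 2 ≤ r₀ ∧ 2 ≤ s₀ ∧ ∀ c r s : ℕ, r₀ ≤ r → s₀ ≤ s →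
    ∀ᶠ m : ℕ in atTop, ∀ φ : GateFn, IsGRankGate (m ^ c) φ →
      ∀ C : Fin φ.1 → Finset (Finset ((⊤ : SimpleGraph (Fin m)).edgeSet)),
        #(univ.image C) ≤ m ^ (c + 3) → (∀ j, ∀ S ∈ C j, #S ≤ s - 1) →
        ∃ dnf cnf : Finset (Finset ((⊤ : SimpleGraph (Fin m)).edgeSet)),
          (∀ R ∈ dnf, #R ≤ r - 1) ∧ (∀ S ∈ cnf, #S ≤ s - 1) ∧
          (∀ x, EvalDNF dnf x → EvalCNF cnf x) ∧
          (#((posGraphs m ⌈(m : ℝ) ^ (1 / 4 : ℝ)⌉₊).filter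
              (fun x => φ.2 (fun j => decide (EvalCNF (C j) x)) = true ∧ ¬ EvalDNF dnf x)) : ℝ)
            ≤ (1 / (8 * (m : ℝ) ^ (c + 1))) * #(posGraphs m ⌈(m : ℝ) ^ (1 / 4 : ℝ)⌉₊) ∧
          (#((((powersetCard (Fintype.card ((⊤ : SimpleGraph (Fin m)).edgeSet) / ⌊(m : ℝ) ^ (1 / 8 : ℝ)⌋₊)
          (univ : Finset ((⊤ : SimpleGraph (Fin m)).edgeSet))).image (fun M => fun e => decide (e ∉ M)))).filter
              (fun x => EvalCNF cnf x ∧ φ.2 (fun j => decide (EvalCNF (C j) x)) = false)) : ℝ)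
            ≤ (1 / (8 * (m : ℝ) ^ (c + 1))) *
              #(((powersetCard (Fintype.card ((⊤ : SimpleGraph (Fin m)).edgeSet) / ⌊(m : ℝ) ^ (1 / 8 : ℝ)⌋₊)
          (univ : Finset ((⊤ : SimpleGraph (Fin m)).edgeSet))).image (fun M => fun e => decide (e ∉ M)))) :=
  not_uniform_of_atFalse _ grankCnfAllAt_false

open Classical in
/-- **Admissible thresholds of the GRANK leaf are quadratic in `c`**: if `(r₀, s₀)` witnesses the r8 GRANK leaf at level `c`
(`2 ≤ r₀`, `2 ≤ s₀`), then `C(j,2) < r₀` for every `j` with `3j < 4(c+1)` — so `r₀(c) > C(⌈4(c+1)/3⌉ - 1, 2)`, and the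
engine's `r₀ = C(4(a+c+2), 2) + 2` (`RealInline.realInline_of_engine`) is order-optimal. [folklore] -/
theorem grankCnfAll_threshold : ∀ c r₀ s₀ : ℕ, 2 ≤ r₀ → 2 ≤ s₀ →
    (∀ r s : ℕ, r₀ ≤ r → s₀ ≤ s →
    ∀ᶠ m : ℕ in atTop, ∀ φ : GateFn, IsGRankGate (m ^ c) φ →
      ∀ C : Fin φ.1 → Finset (Finset ((⊤ : SimpleGraph (Fin m)).edgeSet)),
        #(univ.image C) ≤ m ^ (c + 3) → (∀ j, ∀ S ∈ C j, #S ≤ s - 1) →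
        ∃ dnf cnf : Finset (Finset ((⊤ : SimpleGraph (Fin m)).edgeSet)),
          (∀ R ∈ dnf, #R ≤ r - 1) ∧ (∀ S ∈ cnf, #S ≤ s - 1) ∧
          (∀ x, EvalDNF dnf x → EvalCNF cnf x) ∧
          (#((posGraphs m ⌈(m : ℝ) ^ (1 / 4 : ℝ)⌉₊).filter
              (fun x => φ.2 (fun j => decide (EvalCNF (C j) x)) = true ∧ ¬ EvalDNF dnf x)) : ℝ)
            ≤ (1 / (8 * (m : ℝ) ^ (c + 1))) * #(posGraphs m ⌈(m : ℝ) ^ (1 / 4 : ℝ)⌉₊) ∧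
          (#((((powersetCard (Fintype.card ((⊤ : SimpleGraph (Fin m)).edgeSet) / ⌊(m : ℝ) ^ (1 / 8 : ℝ)⌋₊)
          (univ : Finset ((⊤ : SimpleGraph (Fin m)).edgeSet))).image (fun M => fun e => decide (e ∉ M)))).filter
              (fun x => EvalCNF cnf x ∧ φ.2 (fun j => decide (EvalCNF (C j) x)) = false)) : ℝ)
            ≤ (1 / (8 * (m : ℝ) ^ (c + 1))) *
              #(((powersetCard (Fintype.card ((⊤ : SimpleGraph (Fin m)).edgeSet) / ⌊(m : ℝ) ^ (1 / 8 : ℝ)⌋₊)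
          (univ : Finset ((⊤ : SimpleGraph (Fin m)).edgeSet))).image (fun M => fun e => decide (e ∉ M))))) →
    ∀ j : ℕ, 3 * j < 4 * (c + 1) → j.choose 2 < r₀ :=
  threshold_of_atFalse _ grankCnfAllAt_false

open Classical in
/-- **Uniform locality is FALSE for the CONV leaf**: there is no single threshold pair `(r₀, s₀)` making the r8 CONV leaf body
hold for every size exponent `c` (strategist census S9; the shape that would let children-free raw-gate leaves imply the
registered ones). [folklore] -/
theorem not_convCnfAll_uniform : ¬ ∃ r₀ s₀ : ℕ, 2 ≤ r₀ ∧ 2 ≤ s₀ ∧ ∀ c r s : ℕ, r₀ ≤ r → s₀ ≤ s →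
    ∀ᶠ m : ℕ in atTop, ∀ φ : GateFn, IsConvGate (m ^ c) φ →
      ∀ C : Fin φ.1 → Finset (Finset ((⊤ : SimpleGraph (Fin m)).edgeSet)),
        #(univ.image C) ≤ m ^ (c + 3) → (∀ j, ∀ S ∈ C j, #S ≤ s - 1) →
        ∃ dnf cnf : Finset (Finset ((⊤ : SimpleGraph (Fin m)).edgeSet)),
          (∀ R ∈ dnf, #R ≤ r - 1) ∧ (∀ S ∈ cnf, #S ≤ s - 1) ∧
          (∀ x, EvalDNF dnf x → EvalCNF cnf x) ∧
          (#((posGraphs m ⌈(m : ℝ) ^ (1 / 4 : ℝ)⌉₊).filter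
              (fun x => φ.2 (fun j => decide (EvalCNF (C j) x)) = true ∧ ¬ EvalDNF dnf x)) : ℝ)
            ≤ (1 / (8 * (m : ℝ) ^ (c + 1))) * #(posGraphs m ⌈(m : ℝ) ^ (1 / 4 : ℝ)⌉₊) ∧
          (#((((powersetCard (Fintype.card ((⊤ : SimpleGraph (Fin m)).edgeSet) / ⌊(m : ℝ) ^ (1 / 8 : ℝ)⌋₊)
          (univ : Finset ((⊤ : SimpleGraph (Fin m)).edgeSet))).image (fun M => fun e => decide (e ∉ M)))).filter
              (fun x => EvalCNF cnf x ∧ φ.2 (fun j => decide (EvalCNF (C j) x)) = false)) : ℝ)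
            ≤ (1 / (8 * (m : ℝ) ^ (c + 1))) *
              #(((powersetCard (Fintype.card ((⊤ : SimpleGraph (Fin m)).edgeSet) / ⌊(m : ℝ) ^ (1 / 8 : ℝ)⌋₊)
          (univ : Finset ((⊤ : SimpleGraph (Fin m)).edgeSet))).image (fun M => fun e => decide (e ∉ M)))) :=
  not_uniform_of_atFalse _ convCnfAllAt_false

open Classical in
/-- **Admissible thresholds of the CONV leaf are quadratic in `c`**: if `(r₀, s₀)` witnesses the r8 CONV leaf at level `c`
(`2 ≤ r₀`, `2 ≤ s₀`), then `C(j,2) < r₀` for every `j` with `3j < 4(c+1)` — so `r₀(c) > C(⌈4(c+1)/3⌉ - 1, 2)`, and the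
engine's `r₀ = C(4(a+c+2), 2) + 2` (`RealInline.realInline_of_engine`) is order-optimal. [folklore] -/
theorem convCnfAll_threshold : ∀ c r₀ s₀ : ℕ, 2 ≤ r₀ → 2 ≤ s₀ →
    (∀ r s : ℕ, r₀ ≤ r → s₀ ≤ s →
    ∀ᶠ m : ℕ in atTop, ∀ φ : GateFn, IsConvGate (m ^ c) φ →
      ∀ C : Fin φ.1 → Finset (Finset ((⊤ : SimpleGraph (Fin m)).edgeSet)),
        #(univ.image C) ≤ m ^ (c + 3) → (∀ j, ∀ S ∈ C j, #S ≤ s - 1) →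
        ∃ dnf cnf : Finset (Finset ((⊤ : SimpleGraph (Fin m)).edgeSet)),
          (∀ R ∈ dnf, #R ≤ r - 1) ∧ (∀ S ∈ cnf, #S ≤ s - 1) ∧
          (∀ x, EvalDNF dnf x → EvalCNF cnf x) ∧
          (#((posGraphs m ⌈(m : ℝ) ^ (1 / 4 : ℝ)⌉₊).filter
              (fun x => φ.2 (fun j => decide (EvalCNF (C j) x)) = true ∧ ¬ EvalDNF dnf x)) : ℝ)
            ≤ (1 / (8 * (m : ℝ) ^ (c + 1))) * #(posGraphs m ⌈(m : ℝ) ^ (1 / 4 : ℝ)⌉₊) ∧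
          (#((((powersetCard (Fintype.card ((⊤ : SimpleGraph (Fin m)).edgeSet) / ⌊(m : ℝ) ^ (1 / 8 : ℝ)⌋₊)
          (univ : Finset ((⊤ : SimpleGraph (Fin m)).edgeSet))).image (fun M => fun e => decide (e ∉ M)))).filter
              (fun x => EvalCNF cnf x ∧ φ.2 (fun j => decide (EvalCNF (C j) x)) = false)) : ℝ)
            ≤ (1 / (8 * (m : ℝ) ^ (c + 1))) *
              #(((powersetCard (Fintype.card ((⊤ : SimpleGraph (Fin m)).edgeSet) / ⌊(m : ℝ) ^ (1 / 8 : ℝ)⌋₊)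
          (univ : Finset ((⊤ : SimpleGraph (Fin m)).edgeSet))).image (fun M => fun e => decide (e ∉ M))))) →
    ∀ j : ℕ, 3 * j < 4 * (c + 1) → j.choose 2 < r₀ :=
  threshold_of_atFalse _ convCnfAllAt_false

end Summit.PneNP.PneNP.Theorems.CliqueExtLowerBound.WidthThreshold.LocalityMustGrow

end
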